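import Summits.CriticalPhenomena.PercolationContinuityZ3.Theorems.Transplant.FKThreeApexRimStep
import Summits.CriticalPhenomena.PercolationContinuityZ3.Theorems.Transplant.FKThreeApexPinned
import HarnessLib

/-!
# Double fans: the BIVECTOR CALCULUS of a same-apex spoke pair (hat coordinates, Plücker coordinates, the operators `T`, `∧²D`, `∧²M`)

Helper file (`--supports stmt-CriticalPhenomena-4575`), FK sub-lane `prim-bschramm-fk-3` (gen 24); builds on p205010 (kernel theorem, internal
audit signed; external expert review pending).  Pure real algebra: no measures, no named facts, no sorries; standard axioms.  Memo
`bschramm/prim-bschramm-fk-3/ALL-SAME-APEX.md` (§1–§3) and `SAME-APEX-LEAN.md`.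

Setting.  Two spokes `e = a c_i`, `f = a c_{i+d}` of the SAME apex of a weighted double fan `K₂ ∨ P_{m+1}`; `u` is the fibre-mass vector of
everything glued at `c_i` except `e`, `s` that of everything from `c_{i+d}` on (read backwards), and `𝒜` the word of rim steps `E_r`
(`…ThreeApexRimStep`) and middle spokes `AC(x) BC(y)` between them.  The four pinned partition functions are `Z^{αβ} = val_q(s ∗ AC^β ∗ 𝒜(AC^α u))`
and the Rayleigh difference `Δ = Z¹⁰Z⁰¹ − Z¹¹Z⁰⁰` depends on the pair `(𝒜(AC¹u), 𝒜(AC⁰u))` only through its BIVECTOR.  In hat coordinates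
`ĥ = (û, x̂, ŷ, ẑ, v̂) = (Z_0, Z_0+Z_ab, Z_0+Z_ac, Z_0+Z_bc, ΣZ)` letters act diagonally (`AC(x)BC(y) ↦ M = diag(ab, ab, b, a, 1)`, `a = 1−x`,
`b = 1−y`), the rim step is `E_r = r·I + (1−r)·D` with the rank-two `D ĥ = (ŷ+ẑ−(2−q)û)·w₁ + (v̂−(1−q)x̂)·w₂`, `w₁ = (1,0,1,1,0)`, `w₂ = (0,1,0,0,1)`, and
the gluing pairing `val_q(s ∗ X)` is diagonal.  This file provides, on the ten Plücker coordinates `B10` of `ĥ(Y₁) ∧ ĥ(Y₀)` (**`wedgeV`**):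
* the transport identities **`wedgeV_rimStep`** (`∧²E_r = r²·I + r(1−r)·T + (1−r)²·∧²D`, **`stepE`**, with **`opT`** `= D∧I + I∧D` and `∧²D β = cfun(β)·e_k`,
  `e_k = w₁ ∧ w₂` the axis bivector, **`cfun`**) and **`wedgeV_letters`** (`∧²M`, **`scaleM`**);
* the Rayleigh difference as a pairing **`rayleigh_eq_pairF`**: `Z¹⁰Z⁰¹ − Z¹¹Z⁰⁰ = pairF q s (wedgeV Y₁ Y₀)`, and its self-adjointness under letters
  **`pairF_scaleM`**;
* the seven coordinates `K7 = (k, a_u, a_x, a_y, b_u, b_x, b_y)` of the subspace `W ∧ V` (image of `T`), the embedding **`iota`**, and the identities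
  **`opT_scaleM_iota`** (`T ∘ ∧²M ∘ ι = ι ∘ L_M` with the `7 × 7` matrix **`LM`** of the memo, Appendix A), **`two_cfun_scaleM_iota`** (`2·cfun = φ ∘ L_M`,
  **`phiK`**), **`opT_omega`** (`T ω_u = ι S(u)`, **`Svec`**), **`cfun_omega`** (`cfun ω_u = −N^{(bc)}(u)`), **`pairF_iota`** (`pairF = q²(1−q)·Fdot`, **`Fdot`**),
  and the parallel-spokes value **`pairF_omega`** `= q²(1−q)(v̂v̂'−(1−q)ŷŷ')(x̂x̂'+ẑẑ'−(2−q)ûû') ≥ 0` (**`pairF_omega_nonneg`**).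
All identities were derived symbolically and are re-proved here by `ring`; the invariant cone and the induction are the next files.
[cite: Grimmett2006, §3.9 eq. (3.94) (pp. 63–64)] [folklore]
-/

noncomputable section

namespace Summit.CriticalPhenomena.PercolationContinuityZ3.Theorems

namespace FK

namespace ThreeApex

/-! ### Bivectors in Plücker coordinates -/

/-- A bivector of `ℝ⁵` (hat coordinates `û, x̂, ŷ, ẑ, v̂`) by its ten Plücker coordinates `p_{ij}`, `i < j` in the order `u, x, y, z, v`. [folklore] -/
@[ext] structure B10 where
  /-- `p_{ux}` -/
  pux : ℝ
  /-- `p_{uy}` -/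
  puy : ℝ
  /-- `p_{uz}` -/
  puz : ℝ
  /-- `p_{uv}` -/
  puv : ℝ
  /-- `p_{xy}` -/
  pxy : ℝ
  /-- `p_{xz}` -/
  pxz : ℝ
  /-- `p_{xv}` -/
  pxv : ℝ
  /-- `p_{yz}` -/
  pyz : ℝ
  /-- `p_{yv}` -/
  pyv : ℝ
  /-- `p_{zv}` -/
  pzv : ℝ

namespace B10

/-- Coordinatewise sum of bivectors. [folklore] -/
instance : Add B10 :=
  ⟨fun β γ => ⟨β.pux + γ.pux, β.puy + γ.puy, β.puz + γ.puz, β.puv + γ.puv, β.pxy + γ.pxy, β.pxz + γ.pxz, β.pxv + γ.pxv, β.pyz + γ.pyz,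
    β.pyv + γ.pyv, β.pzv + γ.pzv⟩⟩

/-- Real scalar multiple of a bivector. [folklore] -/
instance : SMul ℝ B10 :=
  ⟨fun c β => ⟨c * β.pux, c * β.puy, c * β.puz, c * β.puv, c * β.pxy, c * β.pxz, c * β.pxv, c * β.pyz, c * β.pyv, c * β.pzv⟩⟩

variable (β γ : B10) (c : ℝ)

/-- coordinate of a sum [folklore] -/ @[simp] theorem add_pux : (β + γ).pux = β.pux + γ.pux := rfl
/-- coordinate of a sum [folklore] -/ @[simp] theorem add_puy : (β + γ).puy = β.puy + γ.puy := rfl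
/-- coordinate of a sum [folklore] -/ @[simp] theorem add_puz : (β + γ).puz = β.puz + γ.puz := rfl
/-- coordinate of a sum [folklore] -/ @[simp] theorem add_puv : (β + γ).puv = β.puv + γ.puv := rfl
/-- coordinate of a sum [folklore] -/ @[simp] theorem add_pxy : (β + γ).pxy = β.pxy + γ.pxy := rfl
/-- coordinate of a sum [folklore] -/ @[simp] theorem add_pxz : (β + γ).pxz = β.pxz + γ.pxz := rfl
/-- coordinate of a sum [folklore] -/ @[simp] theorem add_pxv : (β + γ).pxv = β.pxv + γ.pxv := rfl
/-- coordinate of a sum [folklore] -/ @[simp] theorem add_pyz : (β + γ).pyz = β.pyz + γ.pyz := rfl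
/-- coordinate of a sum [folklore] -/ @[simp] theorem add_pyv : (β + γ).pyv = β.pyv + γ.pyv := rfl
/-- coordinate of a sum [folklore] -/ @[simp] theorem add_pzv : (β + γ).pzv = β.pzv + γ.pzv := rfl
/-- coordinate of a multiple [folklore] -/ @[simp] theorem smul_pux : (c • β).pux = c * β.pux := rfl
/-- coordinate of a multiple [folklore] -/ @[simp] theorem smul_puy : (c • β).puy = c * β.puy := rfl
/-- coordinate of a multiple [folklore] -/ @[simp] theorem smul_puz : (c • β).puz = c * β.puz := rfl
/-- coordinate of a multiple [folklore] -/ @[simp] theorem smul_puv : (c • β).puv = c * β.puv := rfl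
/-- coordinate of a multiple [folklore] -/ @[simp] theorem smul_pxy : (c • β).pxy = c * β.pxy := rfl
/-- coordinate of a multiple [folklore] -/ @[simp] theorem smul_pxz : (c • β).pxz = c * β.pxz := rfl
/-- coordinate of a multiple [folklore] -/ @[simp] theorem smul_pxv : (c • β).pxv = c * β.pxv := rfl
/-- coordinate of a multiple [folklore] -/ @[simp] theorem smul_pyz : (c • β).pyz = c * β.pyz := rfl
/-- coordinate of a multiple [folklore] -/ @[simp] theorem smul_pyv : (c • β).pyv = c * β.pyv := rfl
/-- coordinate of a multiple [folklore] -/ @[simp] theorem smul_pzv : (c • β).pzv = c * β.pzv := rfl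

end B10

/-- **The bivector of a pair of fibre-mass vectors**: the Plücker coordinates `ĥ(Y₁)_i ĥ(Y₀)_j − ĥ(Y₁)_j ĥ(Y₀)_i` of `ĥ(Y₁) ∧ ĥ(Y₀)` in hat
coordinates `(û, x̂, ŷ, ẑ, v̂) = (Z_0, Z_0+Z_ab, Z_0+Z_ac, Z_0+Z_bc, ΣZ)`. [folklore] -/
def wedgeV (Y1 Y0 : V5) : B10 :=
  ⟨Y1.z0 * (Y0.z0 + Y0.zab) - (Y1.z0 + Y1.zab) * Y0.z0,
   Y1.z0 * (Y0.z0 + Y0.zac) - (Y1.z0 + Y1.zac) * Y0.z0,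
   Y1.z0 * (Y0.z0 + Y0.zbc) - (Y1.z0 + Y1.zbc) * Y0.z0,
   Y1.z0 * Y0.total - Y1.total * Y0.z0,
   (Y1.z0 + Y1.zab) * (Y0.z0 + Y0.zac) - (Y1.z0 + Y1.zac) * (Y0.z0 + Y0.zab),
   (Y1.z0 + Y1.zab) * (Y0.z0 + Y0.zbc) - (Y1.z0 + Y1.zbc) * (Y0.z0 + Y0.zab),
   (Y1.z0 + Y1.zab) * Y0.total - Y1.total * (Y0.z0 + Y0.zab),
   (Y1.z0 + Y1.zac) * (Y0.z0 + Y0.zbc) - (Y1.z0 + Y1.zbc) * (Y0.z0 + Y0.zac),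
   (Y1.z0 + Y1.zac) * Y0.total - Y1.total * (Y0.z0 + Y0.zac),
   (Y1.z0 + Y1.zbc) * Y0.total - Y1.total * (Y0.z0 + Y0.zbc)⟩

/-- **`∧²M`** for the merged spokes `M = diag(ab, ab, b, a, 1)` at one rim vertex (`a = 1 − x`, `b = 1 − y` the complementary spoke weights):
`p_{ij} ↦ M_i M_j p_{ij}`. [folklore] -/
def scaleM (a b : ℝ) (β : B10) : B10 :=
  ⟨a * b * (a * b) * β.pux, a * b * b * β.puy, a * b * a * β.puz, a * b * β.puv, a * b * b * β.pxy, a * b * a * β.pxz, a * b * β.pxv,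
   b * a * β.pyz, b * β.pyv, a * β.pzv⟩

/-- **`T = D ∧ I + I ∧ D`** on bivectors, `D` the detach map in hat coordinates (`D e_u = −(2−q)w₁`, `D e_x = −(1−q)w₂`, `D e_y = D e_z = w₁`,
`D e_v = w₂`). [folklore] -/
def opT (q : ℝ) (β : B10) : B10 :=
  ⟨-(3 - 2 * q) * β.pux + β.puv - β.pxy - β.pxz,
   -(1 - q) * β.puy + β.puz - β.pyz,
   β.puy - (1 - q) * β.puz + β.pyz,
   -(1 - q) * β.pux - (1 - q) * β.puv + β.pyv + β.pzv,
   (2 - q) * β.pux + q * β.pxy + β.pxz - β.pyv,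
   (2 - q) * β.pux + β.pxy + q * β.pxz - β.pzv,
   q * β.pxv,
   (2 - q) * β.puy - (2 - q) * β.puz + 2 * β.pyz,
   -(2 - q) * β.puv + (1 - q) * β.pxy + 2 * β.pyv + β.pzv,
   -(2 - q) * β.puv + (1 - q) * β.pxz + β.pyv + 2 * β.pzv⟩

/-- The functional `𝔠 = U ∧ V'` with `∧²D β = 𝔠(β)·(w₁ ∧ w₂)`. [folklore] -/
def cfun (q : ℝ) (β : B10) : ℝ :=
  (1 - q) * (2 - q) * β.pux - (2 - q) * β.puv + (1 - q) * β.pxy + (1 - q) * β.pxz + β.pyv + β.pzv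

/-! ### The seven coordinates of `W ∧ V` -/

/-- A vector of the seven-dimensional subspace `W ∧ V` (`W = im D = ⟨w₁, w₂⟩`) in the coordinates
`σ = k·w₁∧w₂ + a_u·w₁∧e_u + a_x·w₁∧e_x + a_y·w₁∧e_y + b_u·w₂∧e_u + b_x·w₂∧e_x + b_y·w₂∧e_y` of the memo. [folklore] -/
@[ext] structure K7 where
  /-- coefficient of `w₁ ∧ w₂` (the axis bivector `e_k`) -/
  k : ℝ
  /-- coefficient of `w₁ ∧ e_u` -/
  aU : ℝ
  /-- coefficient of `w₁ ∧ e_x` -/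
  aX : ℝ
  /-- coefficient of `w₁ ∧ e_y` -/
  aY : ℝ
  /-- coefficient of `w₂ ∧ e_u` -/
  bU : ℝ
  /-- coefficient of `w₂ ∧ e_x` -/
  bX : ℝ
  /-- coefficient of `w₂ ∧ e_y` -/
  bY : ℝ

/-- The axis bivector `e_k = w₁ ∧ w₂` in `K7` coordinates. [folklore] -/
def ekK : K7 := ⟨1, 0, 0, 0, 0, 0, 0⟩

/-- The embedding `ι : W ∧ V → ∧²ℝ⁵` in Plücker coordinates (`w₁ = e_u + e_y + e_z`, `w₂ = e_x + e_v`). [folklore] -/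
def iota (κ : K7) : B10 :=
  ⟨κ.k + κ.aX - κ.bU, -κ.aU + κ.aY, -κ.aU, κ.k - κ.bU, -κ.k - κ.aX + κ.bY, -κ.k - κ.aX, -κ.bX, -κ.aY, κ.k - κ.bY, κ.k⟩

/-- **`∧²E_r`** on bivectors: `r²·β + r(1−r)·Tβ + (1−r)²·𝔠(β)·e_k`. [folklore] -/
def stepE (q r : ℝ) (β : B10) : B10 := (r ^ 2) • β + (r * (1 - r)) • opT q β + ((1 - r) ^ 2 * cfun q β) • iota ekK

/-- The functional `φ(σ) = q k − (1−q) a_x + (2−q) b_u − b_y` (`T = q·Id + e_k ⊗ φ` on `W ∧ V`). [folklore] -/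
def phiK (q : ℝ) (κ : K7) : ℝ := q * κ.k - (1 - q) * κ.aX + (2 - q) * κ.bU - κ.bY

/-- **`L_M = T ∘ ∧²M`** restricted to `W ∧ V` (memo Appendix A; block diagonal `{k, a_x, b_u, b_y} ⊕ {a_u, a_y} ⊕ {b_x}`). [folklore] -/
def LM (q a b : ℝ) (κ : K7) : K7 :=
  ⟨(2 * a + b - (2 - q) * a * b - (1 - q) * a ^ 2 * b) * κ.k - (1 - q) * a ^ 2 * b * κ.aX + (2 - q) * a * b * κ.bU - b * κ.bY,
   a * b * (q * a + b - a) * κ.aU + a * b * (1 - b) * κ.aY,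
   (-(2 - q) * a ^ 2 * b ^ 2 + a * b ^ 2 + a ^ 2 * b + (2 - q) * a * b - a - b) * κ.k + (a * b * (a + b) - (2 - q) * a ^ 2 * b ^ 2) * κ.aX
      - (2 - q) * a * b * (1 - a * b) * κ.bU + b * (1 - a * b) * κ.bY,
   (2 - q) * a * b * (b - a) * κ.aU + a * b * (2 - (2 - q) * b) * κ.aY,
   (a * (1 - b) - (1 - q) * a ^ 2 * b * (1 - b)) * κ.k - (1 - q) * a ^ 2 * b * (1 - b) * κ.aX + a * b * (1 - (1 - q) * a * b) * κ.bU,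
   q * a * b * κ.bX,
   (a - b) * (1 - (1 - q) * a * b) * κ.k - (1 - q) * a * b * (a - b) * κ.aX + b * (1 - (1 - q) * a * b) * κ.bY⟩

/-- **The initial state `S(u) = T ω_u`** in `K7` coordinates, `ω_u = ĥ(AC¹u) ∧ ĥ(AC⁰u)`; it depends on `u` only through the six products
`m(u) = (v̂x̂, v̂û, v̂ẑ, ŷx̂, ŷû, ŷẑ)` (`S = A m`). [folklore] -/
def Svec (q : ℝ) (u : V5) : K7 :=
  ⟨(2 - q) * (u.total * u.z0) - 2 * (u.total * (u.z0 + u.zbc)),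
   (u.z0 + u.zac) * u.z0 - (u.z0 + u.zac) * (u.z0 + u.zbc),
   -(2 - q) * (u.total * u.z0) + u.total * (u.z0 + u.zbc) + (u.z0 + u.zac) * (u.z0 + u.zab),
   (2 - q) * ((u.z0 + u.zac) * u.z0) - 2 * ((u.z0 + u.zac) * (u.z0 + u.zbc)),
   u.total * u.z0 - u.total * (u.z0 + u.zbc),
   q * (u.total * (u.z0 + u.zab)),
   -(u.total * (u.z0 + u.zbc)) + (1 - q) * ((u.z0 + u.zac) * (u.z0 + u.zab))⟩

/-- **The final functional** `F(s)/(q²(1−q))` on `W ∧ V` (`F = B̃ m(s)`): `Fdot q s κ = Σ_c (B̃ m(s))_c κ_c`. [folklore] -/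
def Fdot (q : ℝ) (s : V5) (κ : K7) : ℝ :=
  ((2 - q) * (s.total * s.z0) - s.total * (s.z0 + s.zbc) - (1 - q) * ((s.z0 + s.zac) * (s.z0 + s.zab))) * κ.k
  + (1 - q) * (2 - q) * ((s.z0 + s.zac) * s.z0) * κ.aU
  - (1 - q) * ((s.z0 + s.zac) * (s.z0 + s.zab)) * κ.aX
  + (-(1 - q) * (2 - q) * ((s.z0 + s.zac) * s.z0) + (1 - q) * ((s.z0 + s.zac) * (s.z0 + s.zbc))) * κ.aY
  - (2 - q) * (s.total * s.z0) * κ.bU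
  + s.total * (s.z0 + s.zab) * κ.bX
  + (1 - q) * ((s.z0 + s.zac) * (s.z0 + s.zab)) * κ.bY

/-- **The Rayleigh pairing** `β ↦ −𝔅(β, ĥ(AC¹s) ∧ ĥ(AC⁰s))` (`𝔅` induced by the diagonal gluing pairing with weights
`c = q((1−q)(2−q), −(1−q), −(1−q), −(1−q), 1)`); only the six Plücker coordinates meeting `ŷ` or `v̂` enter. [folklore] -/
def pairF (q : ℝ) (s : V5) (β : B10) : ℝ :=
  -(q ^ 2 * (1 - q)) * ((1 - q) * (2 - q) * β.puy * ((s.z0 + s.zac) * s.z0) - (2 - q) * β.puv * (s.total * s.z0)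
    - (1 - q) * β.pxy * ((s.z0 + s.zac) * (s.z0 + s.zab)) + β.pxv * (s.total * (s.z0 + s.zab))
    + (1 - q) * β.pyz * ((s.z0 + s.zac) * (s.z0 + s.zbc)) + β.pzv * (s.total * (s.z0 + s.zbc)))

/-! ### Transport identities -/

/-- **`∧²E_r`**: the bivector of the pair after a rim step. [folklore] -/
theorem wedgeV_rimStep (q r : ℝ) (Y1 Y0 : V5) : wedgeV (rimStep q r Y1) (rimStep q r Y0) = stepE q r (wedgeV Y1 Y0) := by
  ext <;> simp only [wedgeV, rimStep, stepE, opT, cfun, iota, ekK, V5.total, B10.add_pux, B10.add_puy, B10.add_puz, B10.add_puv,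
    B10.add_pxy, B10.add_pxz, B10.add_pxv, B10.add_pyz, B10.add_pyv, B10.add_pzv, B10.smul_pux, B10.smul_puy, B10.smul_puz,
    B10.smul_puv, B10.smul_pxy, B10.smul_pxz, B10.smul_pxv, B10.smul_pyz, B10.smul_pyv, B10.smul_pzv] <;> ring

/-- **`∧²M`**: the bivector of the pair after the two spokes `AC(x) BC(y)` of a middle rim vertex. [folklore] -/
theorem wedgeV_letters (x y : ℝ) (Y1 Y0 : V5) :
    wedgeV (conv (edgeAC x) (conv (edgeBC y) Y1)) (conv (edgeAC x) (conv (edgeBC y) Y0)) = scaleM (1 - x) (1 - y) (wedgeV Y1 Y0) := by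
  ext <;> simp only [wedgeV, conv, edgeAC, edgeBC, scaleM, V5.total] <;> ring

/-- `∧²M ∘ ∧²M' = ∧²(MM')` (letters merge). [folklore] -/
theorem scaleM_scaleM (a b a' b' : ℝ) (β : B10) : scaleM a b (scaleM a' b' β) = scaleM (a * a') (b * b') β := by
  ext <;> simp only [scaleM] <;> ring

/-- `∧²M(1,1) = id`. [folklore] -/
theorem scaleM_one (β : B10) : scaleM 1 1 β = β := by
  ext <;> simp only [scaleM] <;> ring

/-- `∧²M` is additive. [folklore] -/
theorem scaleM_add (a b : ℝ) (β γ : B10) : scaleM a b (β + γ) = scaleM a b β + scaleM a b γ := by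
  ext <;> simp only [scaleM, B10.add_pux, B10.add_puy, B10.add_puz, B10.add_puv, B10.add_pxy, B10.add_pxz, B10.add_pxv, B10.add_pyz,
    B10.add_pyv, B10.add_pzv] <;> ring

/-- `∧²M` commutes with scalars. [folklore] -/
theorem scaleM_smul (a b c : ℝ) (β : B10) : scaleM a b (c • β) = c • scaleM a b β := by
  ext <;> simp only [scaleM, B10.smul_pux, B10.smul_puy, B10.smul_puz, B10.smul_puv, B10.smul_pxy, B10.smul_pxz, B10.smul_pxv,
    B10.smul_pyz, B10.smul_pyv, B10.smul_pzv] <;> ring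

/-- `∧²E_r` is additive. [folklore] -/
theorem stepE_add (q r : ℝ) (β γ : B10) : stepE q r (β + γ) = stepE q r β + stepE q r γ := by
  ext <;> simp only [stepE, opT, cfun, iota, ekK, B10.add_pux, B10.add_puy, B10.add_puz, B10.add_puv, B10.add_pxy, B10.add_pxz,
    B10.add_pxv, B10.add_pyz, B10.add_pyv, B10.add_pzv, B10.smul_pux, B10.smul_puy, B10.smul_puz, B10.smul_puv, B10.smul_pxy,
    B10.smul_pxz, B10.smul_pxv, B10.smul_pyz, B10.smul_pyv, B10.smul_pzv] <;> ring

/-- `∧²E_r` commutes with scalars. [folklore] -/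
theorem stepE_smul (q r c : ℝ) (β : B10) : stepE q r (c • β) = c • stepE q r β := by
  ext <;> simp only [stepE, opT, cfun, iota, ekK, B10.add_pux, B10.add_puy, B10.add_puz, B10.add_puv, B10.add_pxy, B10.add_pxz,
    B10.add_pxv, B10.add_pyz, B10.add_pyv, B10.add_pzv, B10.smul_pux, B10.smul_puy, B10.smul_puz, B10.smul_puv, B10.smul_pxy,
    B10.smul_pxz, B10.smul_pxv, B10.smul_pyz, B10.smul_pyv, B10.smul_pzv] <;> ring

/-! ### The Rayleigh difference as a pairing -/

/-- **`Z¹⁰Z⁰¹ − Z¹¹Z⁰⁰ = pairF q s (ĥ(Y₁) ∧ ĥ(Y₀))`** for `Z^{αβ} = val_q(s ∗ AC^β ∗ Y_α)`. [folklore] -/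
theorem rayleigh_eq_pairF (q : ℝ) (s Y1 Y0 : V5) :
    val q (conv s (conv (edgeAC 0) Y1)) * val q (conv s (conv (edgeAC 1) Y0))
        - val q (conv s (conv (edgeAC 1) Y1)) * val q (conv s (conv (edgeAC 0) Y0)) = pairF q s (wedgeV Y1 Y0) := by
  simp only [val, conv, edgeAC, pairF, wedgeV, V5.total]
  ring

/-- **Self-adjointness of the letters**: `pairF q s (∧²M β) = pairF q (AC(x) BC(y) s) β` (`a = 1−x`, `b = 1−y`). [folklore] -/
theorem pairF_scaleM (q x y : ℝ) (s : V5) (β : B10) :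
    pairF q s (scaleM (1 - x) (1 - y) β) = pairF q (conv (edgeAC x) (conv (edgeBC y) s)) β := by
  simp only [pairF, scaleM, conv, edgeAC, edgeBC, V5.total]
  ring

/-- `pairF` is additive in the bivector. [folklore] -/
theorem pairF_add (q : ℝ) (s : V5) (β γ : B10) : pairF q s (β + γ) = pairF q s β + pairF q s γ := by
  simp only [pairF, B10.add_puy, B10.add_puv, B10.add_pxy, B10.add_pxv, B10.add_pyz, B10.add_pzv]
  ring

/-- `pairF` commutes with scalars. [folklore] -/
theorem pairF_smul (q : ℝ) (s : V5) (c : ℝ) (β : B10) : pairF q s (c • β) = c * pairF q s β := by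
  simp only [pairF, B10.smul_puy, B10.smul_puv, B10.smul_pxy, B10.smul_pxv, B10.smul_pyz, B10.smul_pzv]
  ring

/-- On the subspace `W ∧ V`: **`pairF q s (ι κ) = q²(1−q)·Fdot q s κ`**. [folklore] -/
theorem pairF_iota (q : ℝ) (s : V5) (κ : K7) : pairF q s (iota κ) = q ^ 2 * (1 - q) * Fdot q s κ := by
  simp only [pairF, iota, Fdot]
  ring

/-- **The parallel-spokes value**: `pairF q s ω_u = q²(1−q)·(v̂v̂' − (1−q)ŷŷ')·(x̂x̂' + ẑẑ' − (2−q)ûû')` (`ω_u = ĥ(AC¹u) ∧ ĥ(AC⁰u)`; primes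
for `s`). [folklore] -/
theorem pairF_omega (q : ℝ) (s u : V5) :
    pairF q s (wedgeV (conv (edgeAC 1) u) (conv (edgeAC 0) u)) =
      q ^ 2 * (1 - q) * (u.total * s.total - (1 - q) * ((u.z0 + u.zac) * (s.z0 + s.zac)))
        * ((u.z0 + u.zab) * (s.z0 + s.zab) + (u.z0 + u.zbc) * (s.z0 + s.zbc) - (2 - q) * (u.z0 * s.z0)) := by
  simp only [pairF, wedgeV, conv, edgeAC, V5.total]
  ring

/-- The parallel-spokes value is `≥ 0` for vectors with non-negative masses (`0 ≤ q ≤ 1`). [folklore] -/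
theorem pairF_omega_nonneg {q : ℝ} (hq0 : 0 ≤ q) (hq1 : q ≤ 1) {s u : V5} (hu : u.Nonneg) (hs : s.Nonneg) :
    0 ≤ pairF q s (wedgeV (conv (edgeAC 1) u) (conv (edgeAC 0) u)) := by
  rw [pairF_omega]
  obtain ⟨hu0, hu1, hu2, hu3, hu4⟩ := hu
  obtain ⟨hs0, hs1, hs2, hs3, hs4⟩ := hs
  have hq' : 0 ≤ 1 - q := sub_nonneg.2 hq1
  have h1 : 0 ≤ u.total * s.total - (1 - q) * ((u.z0 + u.zac) * (s.z0 + s.zac)) := by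
    have e : u.total * s.total - (1 - q) * ((u.z0 + u.zac) * (s.z0 + s.zac)) =
        (u.zab + u.zbc + u.z1) * s.total + (u.z0 + u.zac) * (s.zab + s.zbc + s.z1) + q * ((u.z0 + u.zac) * (s.z0 + s.zac)) := by
      simp only [V5.total]; ring
    rw [e]
    have : 0 ≤ s.total := by simp only [V5.total]; positivity
    positivity
  have h2 : 0 ≤ (u.z0 + u.zab) * (s.z0 + s.zab) + (u.z0 + u.zbc) * (s.z0 + s.zbc) - (2 - q) * (u.z0 * s.z0) := by
    have e : (u.z0 + u.zab) * (s.z0 + s.zab) + (u.z0 + u.zbc) * (s.z0 + s.zbc) - (2 - q) * (u.z0 * s.z0) =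
        u.zab * (s.z0 + s.zab) + u.z0 * s.zab + u.zbc * (s.z0 + s.zbc) + u.z0 * s.zbc + q * (u.z0 * s.z0) := by ring
    rw [e]; positivity
  positivity

/-! ### The subspace `W ∧ V`: `T ∘ ∧²M ∘ ι = ι ∘ L_M`, `2·𝔠 ∘ ∧²M ∘ ι = φ ∘ L_M`, the initial state -/

/-- **`T (∧²M (ι κ)) = ι (L_M κ)`**: after a letter block and `T` the state is back in `W ∧ V`, with coordinates given by `LM`. [folklore] -/
theorem opT_scaleM_iota (q a b : ℝ) (κ : K7) : opT q (scaleM a b (iota κ)) = iota (LM q a b κ) := by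
  ext <;> simp only [opT, scaleM, iota, LM] <;> ring

/-- **`2·𝔠(∧²M (ι κ)) = φ(L_M κ)`**. [folklore] -/
theorem two_cfun_scaleM_iota (q a b : ℝ) (κ : K7) : 2 * cfun q (scaleM a b (iota κ)) = phiK q (LM q a b κ) := by
  simp only [cfun, scaleM, iota, phiK, LM]
  ring

/-- `ι` is additive. [folklore] -/
theorem iota_add (κ κ' : K7) :
    iota ⟨κ.k + κ'.k, κ.aU + κ'.aU, κ.aX + κ'.aX, κ.aY + κ'.aY, κ.bU + κ'.bU, κ.bX + κ'.bX, κ.bY + κ'.bY⟩ = iota κ + iota κ' := by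
  ext <;> simp only [iota, B10.add_pux, B10.add_puy, B10.add_puz, B10.add_puv, B10.add_pxy, B10.add_pxz, B10.add_pxv, B10.add_pyz,
    B10.add_pyv, B10.add_pzv] <;> ring

/-- `ι` commutes with scalars. [folklore] -/
theorem iota_smul (c : ℝ) (κ : K7) :
    iota ⟨c * κ.k, c * κ.aU, c * κ.aX, c * κ.aY, c * κ.bU, c * κ.bX, c * κ.bY⟩ = c • iota κ := by
  ext <;> simp only [iota, B10.smul_pux, B10.smul_puy, B10.smul_puz, B10.smul_puv, B10.smul_pxy, B10.smul_pxz, B10.smul_pxv,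
    B10.smul_pyz, B10.smul_pyv, B10.smul_pzv] <;> ring

/-- **`T ω_u = ι S(u)`**. [folklore] -/
theorem opT_omega (q : ℝ) (u : V5) : opT q (wedgeV (conv (edgeAC 1) u) (conv (edgeAC 0) u)) = iota (Svec q u) := by
  ext <;> simp only [opT, wedgeV, conv, edgeAC, iota, Svec, V5.total] <;> ring

/-- **`𝔠(ω_u) = −N^{(bc)}(u)`**. [folklore] -/
theorem cfun_omega (q : ℝ) (u : V5) : cfun q (wedgeV (conv (edgeAC 1) u) (conv (edgeAC 0) u)) = -masterN q (swapAB u) := by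
  simp only [cfun, wedgeV, conv, edgeAC, masterN, swapAB, V5.total]
  ring

/-- **`∧²E_r ω_u = r²·ω_u + r(1−r)·ι S(u) + (1−r)² N^{(bc)}(u)·ι(−e_k)`** — the first rim step splits the initial bivector into the
parallel part, the mixed state and the axis part. [folklore] -/
theorem stepE_omega (q r : ℝ) (u : V5) :
    stepE q r (wedgeV (conv (edgeAC 1) u) (conv (edgeAC 0) u)) =
      (r ^ 2) • wedgeV (conv (edgeAC 1) u) (conv (edgeAC 0) u) + (r * (1 - r)) • scaleM 1 1 (iota (Svec q u))
        + ((1 - r) ^ 2 * masterN q (swapAB u)) • scaleM 1 1 (iota ⟨-1, 0, 0, 0, 0, 0, 0⟩) := by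
  rw [stepE, opT_omega, cfun_omega, scaleM_one, scaleM_one]
  ext <;> simp only [iota, ekK, B10.add_pux, B10.add_puy, B10.add_puz, B10.add_puv, B10.add_pxy, B10.add_pxz, B10.add_pxv,
    B10.add_pyz, B10.add_pyv, B10.add_pzv, B10.smul_pux, B10.smul_puy, B10.smul_puz, B10.smul_puv, B10.smul_pxy, B10.smul_pxz,
    B10.smul_pxv, B10.smul_pyz, B10.smul_pyv, B10.smul_pzv] <;> ring

/-- **`∧²E_r (∧²M ι κ) = r²·∧²M ι κ + r(1−r)·ι(L_M κ) + (1−r)²(−φ(L_M κ)/2)·ι(−e_k)`**. [folklore] -/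
theorem stepE_scaleM_iota (q r a b : ℝ) (κ : K7) :
    stepE q r (scaleM a b (iota κ)) =
      (r ^ 2) • scaleM a b (iota κ) + (r * (1 - r)) • scaleM 1 1 (iota (LM q a b κ))
        + ((1 - r) ^ 2 * (-phiK q (LM q a b κ) / 2)) • scaleM 1 1 (iota ⟨-1, 0, 0, 0, 0, 0, 0⟩) := by
  have hc : cfun q (scaleM a b (iota κ)) = phiK q (LM q a b κ) / 2 := by
    have := two_cfun_scaleM_iota q a b κ; linarith
  rw [stepE, opT_scaleM_iota, hc, scaleM_one, scaleM_one]
  ext <;> simp only [iota, ekK, B10.add_pux, B10.add_puy, B10.add_puz, B10.add_puv, B10.add_pxy, B10.add_pxz, B10.add_pxv,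
    B10.add_pyz, B10.add_pyv, B10.add_pzv, B10.smul_pux, B10.smul_puy, B10.smul_puz, B10.smul_puv, B10.smul_pxy, B10.smul_pxz,
    B10.smul_pxv, B10.smul_pyz, B10.smul_pyv, B10.smul_pzv] <;> ring

/-- Letters move the initial bivector to the initial bivector of the lettered vector: `∧²M ω_u = ω_{AC(x)BC(y)u}`. [folklore] -/
theorem scaleM_omega (x y : ℝ) (u : V5) :
    scaleM (1 - x) (1 - y) (wedgeV (conv (edgeAC 1) u) (conv (edgeAC 0) u)) =
      wedgeV (conv (edgeAC 1) (conv (edgeAC x) (conv (edgeBC y) u))) (conv (edgeAC 0) (conv (edgeAC x) (conv (edgeBC y) u))) := by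
  rw [← wedgeV_letters, conv_comm (edgeBC y) (edgeAC 1), conv_comm (edgeAC x) (edgeAC 1), conv_comm (edgeBC y) (edgeAC 0),
    conv_comm (edgeAC x) (edgeAC 0)]

end ThreeApex

end FK

end Summit.CriticalPhenomena.PercolationContinuityZ3.Theorems
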